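import Summits.RiemannHypothesis.RiemannHypothesis.Theses.RobinStaircase
import Summits.RiemannHypothesis.RiemannHypothesis.Theorems.Splittings.RobinFiniteStairSqrt
import HarnessLib

/-!
# Route RobinStaircase (L7 «ROBIN · FINITE STAIRCASE») — `Row18` (item stmt-RiemannHypothesis-22076) closed BY NAME

The row «two θ-prints (Büthe 2018 Thm 2, BKLNW 2021 Table 15) + RH verified to height `T ≥ 1 105 000` ⟹ Robin's
inequality at every colossally abundant `N > 5040` with all primes `< 4^18 = 68719476736`» is, verbatim, the lane (ix-n)
tree theorem `Summit.RiemannHypothesis.RiemannHypothesis.Theorems.Splittings.RobinFiniteC1.robinCA_below_stairS_1105000`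
(Theorems/Splittings/RobinFiniteStairSqrt.lean). One-line closer. CONDITIONAL bookkeeping on the two printed θ-facts and
`RiemannHypothesisUpTo T` (hypotheses, not discharged); RH is not proved by this; nothing here bears on the truth of RH.
-/

-- D-0017: `Summit.RiemannHypothesis.RiemannHypothesis.…` duplicates the namespace BY DESIGN (single-problem summit).
set_option linter.dupNamespace false

namespace Summit.RiemannHypothesis.RiemannHypothesis.Theorems.RobinStaircase

/-- **Row `Row18` (item stmt-RiemannHypothesis-22076)**: θ-prints + `RH(T)`, `T ≥ 1 105 000` ⟹ `robinCA_below 68719476736` — the tree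
theorem `Splittings.RobinFiniteC1.robinCA_below_stairS_1105000`, by name. -/
theorem row18_proof :
    Summit.RiemannHypothesis.RiemannHypothesis.Theses.RobinStaircase.Row18 :=
  fun hB hK _T hT hRH ↦ Splittings.RobinFiniteC1.robinCA_below_stairS_1105000 hB hK hT hRH

end Summit.RiemannHypothesis.RiemannHypothesis.Theorems.RobinStaircase
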